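import Literature.MathematicalPhysics.QuantumLattice.TorusWilsonMarkov
import Literature.MathematicalPhysics.QuantumLattice.WilsonBlockHeatBathSemigroup
import Mathlib.Probability.CondVar

/-!
# Slab inequality ⇒ geometric decay of conditional expectations

Crux `LatticeGapInUVUnits` (`stmt-QuantumFields-9366`), line femto-slab-nondegeneracy, stub S2
(`stub_slabToDecay`, "the engine").  For the torus Wilson measure `μ = wilsonMeasure r.ρ β` on
`(ℤ/(2S+1))⁴` (time = axis `0`), write `slab(t₀, w) = {ℓ | (ℓ.1 0 - t₀).val < w}` for the links based
at times `t₀, …, t₀ + w - 1` and `ext_M(t₀, w) = cylinderEvents (slab(t₀ - (M-1), w + 2(M-1)))ᶜ`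
for the σ-algebra of the links at least `M` base-layers away from the slab.  If for every slab with
`w + 2D ≤ 2S` and every bounded measurable `F` reading only the slab
`Var F ≤ K ∫ (F - μ[F | ext_D])²` (the slab inequality at margin `D ≥ 1`, constant `K ≥ 1`), then
`∫ (μ[F | ext_{jD}] - ∫ F)² ≤ (1 - 1/K)^j Var F` whenever `w + 2jD ≤ 2S`.

Proof: `j = 0` is the `L²`-contraction of conditional expectation; `j = 1` is the slab inequality
plus the law of total variance `∫ (F - μ[F|m])² + ∫ (μ[F|m] - ∫F)² = Var F`; the step `j → j + 1`
replaces `μ[F | ext_{jD}]` by a bounded version `G_j` reading only the enlarged slab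
`slab(t₀ - jD, w + 2jD)` (Markov property of the plaquette interaction,
`WilsonBlockHeatBath.exists_local_condExp_version`), applies the case `j = 1` to `G_j` — the
margin-`D` exterior of the enlarged slab is the margin-`(j+1)D` exterior of the original one — and
uses the tower property along the nested exteriors.
-/

open scoped BigOperators
open MeasureTheory Filter Topology
open Literature.MathematicalPhysics.QuantumFieldTheory Literature.MathematicalPhysics.QuantumLattice

noncomputable section

namespace Summit.QuantumFields.YangMills.Theorems.LatticeGapInUVUnits.FemtoSlabNondegeneracy

/-! ### Abstract `L²` facts on a finite measure space -/

section Abstract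

variable {Ω : Type*} {m : MeasurableSpace Ω} {m0 : MeasurableSpace Ω} {μ : Measure Ω}

/-- **Law of total variance** for a bounded observable on a probability space:
`∫ (F - μ[F|m])² + ∫ (μ[F|m] - ∫ F)² = ∫ (F - ∫ F)²` (Mathlib's
`integral_condVar_add_variance_condExp`, unfolded). -/
theorem integral_sq_sub_condExp_add [IsProbabilityMeasure μ] (hm : m ≤ m0) {F : Ω → ℝ}
    (hF : AEStronglyMeasurable F μ) {M : ℝ} (hb : ∀ᵐ ω ∂μ, |F ω| ≤ M) :
    ∫ ω, (F ω - (μ[F|m]) ω) ^ 2 ∂μ + ∫ ω, ((μ[F|m]) ω - ∫ ω', F ω' ∂μ) ^ 2 ∂μ =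
      ∫ ω, (F ω - ∫ ω', F ω' ∂μ) ^ 2 ∂μ := by
  have hX : MemLp F 2 μ := MemLp.of_bound hF M (hb.mono fun ω h => by rwa [Real.norm_eq_abs])
  have h := ProbabilityTheory.integral_condVar_add_variance_condExp hm hX
  rw [ProbabilityTheory.variance_eq_integral hF.aemeasurable,
    ProbabilityTheory.variance_eq_integral integrable_condExp.aestronglyMeasurable.aemeasurable,
    integral_condExp (f := F) hm, ProbabilityTheory.condVar, integral_condExp hm] at h
  simpa only [Pi.sub_apply, Pi.pow_apply] using h

/-- **Contraction at a constant**: `∫ (μ[F|m] - c)² ≤ ∫ (F - c)²` for a.e. bounded `F`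
(`μ[F - c | m] = μ[F|m] - c` and conditional expectation contracts `L²`). -/
theorem integral_condExp_sub_const_sq_le [IsFiniteMeasure μ] (hm : m ≤ m0) {F : Ω → ℝ}
    (hF : AEStronglyMeasurable F μ) {M : ℝ} (hb : ∀ᵐ ω ∂μ, |F ω| ≤ M) (c : ℝ) :
    ∫ ω, ((μ[F|m]) ω - c) ^ 2 ∂μ ≤ ∫ ω, (F ω - c) ^ 2 ∂μ := by
  have hFi : Integrable F μ := integrable_of_ae_bdd_abs hF hb
  have h1 : μ[fun ω => F ω - c|m] =ᵐ[μ] fun ω => (μ[F|m]) ω - c := by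
    have h := condExp_sub hFi (integrable_const c) m
    rw [condExp_const hm c] at h
    exact h
  have hb' : ∀ᵐ ω ∂μ, |F ω - c| ≤ M + |c| :=
    hb.mono fun ω h => (abs_sub (F ω) c).trans (add_le_add h le_rfl)
  rw [← integral_sq_congr_ae h1]
  exact integral_condExp_sq_le_of_ae_bdd (h := fun ω => F ω - c)
    (hF.sub aestronglyMeasurable_const) hb'

end Abstract

/-! ### Arithmetic -/

/-- From `V ≤ K R` and `R + P = V` with `K ≥ 1`: `P ≤ (1 - 1/K) V`. -/
theorem le_mul_of_total_variance {P R V K : ℝ} (hK : 1 ≤ K) (hV : V ≤ K * R) (hP : R + P = V) :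
    P ≤ (1 - 1 / K) * V := by
  have hK0 : 0 < K := one_pos.trans_le hK
  have h1 : V / K ≤ R := by rw [div_le_iff₀ hK0, mul_comm]; exact hV
  have h2 : (1 - 1 / K) * V = V - V / K := by ring
  linarith

/-- Offsets on a ring of `L` sites: if a plaquette has base offsets `τ` and `(τ + 1) % L` and one of
its links has offset `< n` (`n + 2 < L`), then every link has offset `< n + 2` after shifting the
origin back by one. -/
theorem succ_mod_lt_of_plaquette {L τ n v : ℕ} (hτ : τ < L) (hn : n + 2 < L)
    (hv : v = τ ∨ v = (τ + 1) % L) (h₀ : τ < n ∨ (τ + 1) % L < n) : (v + 1) % L < n + 2 := by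
  have key : ∀ b : ℕ, (b + 1) % L ≤ b + 1 := fun b => Nat.mod_le _ _
  rcases Nat.lt_or_ge (τ + 1) L with h | h
  · rw [Nat.mod_eq_of_lt h] at hv h₀
    have := key v
    omega
  · obtain rfl : L = τ + 1 := le_antisymm h hτ
    rw [Nat.mod_self] at hv h₀
    rcases hv with rfl | rfl
    · rw [Nat.mod_self]; omega
    · have := key 0; omega

/-! ### Slab geometry on the torus `(ℤ/(2S+1))⁴` -/

/-- Enlarging a time-slab by `R` base-layers on both sides contains it (`ZMod.val` is
subadditive; no case distinction on wrap-around is needed). -/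
theorem slab_subset_enlarge {S : ℕ} (c : ZMod (2 * S + 1)) (v R : ℕ) :
    {ℓ : Edge 4 (2 * S + 1) | (ℓ.1 0 - c).val < v} ⊆
      {ℓ : Edge 4 (2 * S + 1) | (ℓ.1 0 - (c - (R : ZMod (2 * S + 1)))).val < v + 2 * R} := by
  intro ℓ hℓ
  simp only [Set.mem_setOf_eq] at hℓ ⊢
  have e : ℓ.1 0 - (c - (R : ZMod (2 * S + 1))) = (ℓ.1 0 - c) + (R : ZMod (2 * S + 1)) := by ring
  rw [e]
  calc ((ℓ.1 0 - c) + (R : ZMod (2 * S + 1))).val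
      ≤ (ℓ.1 0 - c).val + (R : ZMod (2 * S + 1)).val := ZMod.val_add_le _ _
    _ ≤ (ℓ.1 0 - c).val + R := by
        rw [ZMod.val_natCast]; exact Nat.add_le_add_left (Nat.mod_le _ _) _
    _ < v + 2 * R := by omega

/-- **Plaquette geometry**: a plaquette meeting the slab `{(ℓ.1 0 - a).val < n}` (`n + 2 < 2S+1`)
has all its links in the slab enlarged by one layer on each side, `{(ℓ.1 0 - (a - 1)).val < n + 2}`
(its base points have time offsets `τ` or `τ + 1 (mod 2S+1)`). -/
theorem plaquette_subset_enlarge {S : ℕ} (a : ZMod (2 * S + 1)) {n : ℕ} (hn : n + 2 < 2 * S + 1)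
    (Λ : Finset (Edge 4 (2 * S + 1)))
    (hΛ : (↑Λ : Set (Edge 4 (2 * S + 1))) = {ℓ | (ℓ.1 0 - a).val < n})
    (y : Site 4 (2 * S + 1)) (i k : Fin 4)
    (hne : (({(y, i), (y.shift i, k), (y.shift k, i), (y, k)} : Finset (Edge 4 (2 * S + 1))) ∩
      Λ).Nonempty) :
    (↑({(y, i), (y.shift i, k), (y.shift k, i), (y, k)} : Finset (Edge 4 (2 * S + 1))) :
        Set (Edge 4 (2 * S + 1))) ⊆
      ↑Λ ∪ {ℓ : Edge 4 (2 * S + 1) | (ℓ.1 0 - (a - 1)).val < n + 2} := by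
  obtain ⟨e₀, he₀⟩ := hne
  rw [Finset.mem_inter] at he₀
  have he₀Λ : (e₀.1 0 - a).val < n := by
    have h : e₀ ∈ (↑Λ : Set (Edge 4 (2 * S + 1))) := Finset.mem_coe.2 he₀.2
    rw [hΛ] at h
    exact h
  have hbase : ∀ e ∈ ({(y, i), (y.shift i, k), (y.shift k, i), (y, k)} :
      Finset (Edge 4 (2 * S + 1))),
      (e.1 0 - a).val = (y 0 - a).val ∨ (e.1 0 - a).val = ((y 0 - a).val + 1) % (2 * S + 1) := by
    intro e he
    simp only [Finset.mem_insert, Finset.mem_singleton] at he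
    rcases he with rfl | rfl | rfl | rfl
    · exact Or.inl rfl
    · exact val_shift_apply_sub_eq_or y i 0 a
    · exact val_shift_apply_sub_eq_or y k 0 a
    · exact Or.inl rfl
  have h₀ : (y 0 - a).val < n ∨ ((y 0 - a).val + 1) % (2 * S + 1) < n := by
    rcases hbase e₀ he₀.1 with h | h
    · exact Or.inl (h ▸ he₀Λ)
    · exact Or.inr (h ▸ he₀Λ)
  intro e he
  refine Or.inr ?_
  simp only [Set.mem_setOf_eq]
  have e1 : e.1 0 - (a - 1) = (e.1 0 - a) + 1 := by ring
  rw [e1, ZMod.val_add, ZMod.val_one_eq_one_mod, Nat.add_mod_mod]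
  exact succ_mod_lt_of_plaquette (ZMod.val_lt _) hn (hbase e (Finset.mem_coe.1 he)) h₀

section Wilson

variable {G : Type} [Group G] [TopologicalSpace G] [IsTopologicalGroup G] [CompactSpace G]
  [MeasurableSpace G] [BorelSpace G]

/-- **Markov version of the conditional expectation given a slab exterior.** For a bounded
measurable `F` reading only the one-layer enlargement `{(ℓ.1 0 - (a - 1)).val < n + 2}` of the slab
`Λ = {(ℓ.1 0 - a).val < n}` (`n + 2 < 2S+1`), `μ[F | links off Λ]` has a bounded measurable version
reading only that enlargement (locality of the plaquette interaction,
`WilsonBlockHeatBath.exists_local_condExp_version`). -/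
theorem exists_slab_condExp_version (r : LatticeRep G) (β : ℝ) (S : ℕ) (a : ZMod (2 * S + 1))
    (n : ℕ) (hn : n + 2 < 2 * S + 1) {F : GaugeConfig 4 (2 * S + 1) G → ℝ} (hFm : Measurable F)
    {C : ℝ} (hC : ∀ U, |F U| ≤ C)
    (hFd : DependsOn F {ℓ : Edge 4 (2 * S + 1) | (ℓ.1 0 - (a - 1)).val < n + 2}) :
    ∃ F' : GaugeConfig 4 (2 * S + 1) G → ℝ, Measurable F' ∧ (∀ U, |F' U| ≤ C) ∧
      DependsOn F' {ℓ : Edge 4 (2 * S + 1) | (ℓ.1 0 - (a - 1)).val < n + 2} ∧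
      F' =ᵐ[wilsonMeasure (d := 4) (L := 2 * S + 1) r.ρ β]
        (wilsonMeasure (d := 4) (L := 2 * S + 1) r.ρ β)[F|cylinderEvents
          (X := fun _ : Edge 4 (2 * S + 1) => G) {ℓ : Edge 4 (2 * S + 1) | (ℓ.1 0 - a).val < n}ᶜ] := by
  classical
  haveI : SecondCountableTopology G :=
    (r.continuous.isClosedEmbedding r.injective).isEmbedding.secondCountableTopology
  haveI : T2Space G := (r.continuous.isClosedEmbedding r.injective).isEmbedding.t2Space
  set Λ : Finset (Edge 4 (2 * S + 1)) :=
    (Set.toFinite {ℓ : Edge 4 (2 * S + 1) | (ℓ.1 0 - a).val < n}).toFinset with hΛ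
  have hΛc : (↑Λ : Set (Edge 4 (2 * S + 1))) = {ℓ | (ℓ.1 0 - a).val < n} :=
    Set.Finite.coe_toFinset _
  obtain ⟨F', h1, h2, h3, h4⟩ := WilsonBlockHeatBath.exists_local_condExp_version r.ρ
    r.continuous β Λ (T := {ℓ : Edge 4 (2 * S + 1) | (ℓ.1 0 - (a - 1)).val < n + 2})
    (fun y i k _ hne => plaquette_subset_enlarge a hn Λ hΛc y i k hne) hFm hC
    (hFd.mono Set.subset_union_right)
  refine ⟨F', h1, h2, h3, ?_⟩
  rw [hΛc] at h4
  exact h4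

/-- **The induction along nested exteriors** (levels `j ≥ 1`), with the level-`j` interior
parameters `a = t₀ - (jD - 1)`, `n = w + 2(jD - 1)` kept abstract. -/
theorem decay_of_slabInequality (r : LatticeRep G) (β : ℝ) (S D : ℕ) (K : ℝ) (hD : 1 ≤ D)
    (hK : 1 ≤ K)
    (hslab : ∀ (t₀ : ZMod (2 * S + 1)) (w : ℕ), w + 2 * D ≤ 2 * S → ∀ F : GaugeConfig 4 (2 * S + 1) G → ℝ, Measurable F → (∃ M : ℝ, ∀ U, |F U| ≤ M) → DependsOn F {ℓ : Edge 4 (2 * S + 1) | (ℓ.1 0 - t₀).val < w} → ∫ U, (F U - ∫ V, F V ∂(wilsonMeasure (d := 4) (L := 2 * S + 1) r.ρ β)) ^ 2 ∂(wilsonMeasure (d := 4) (L := 2 * S + 1) r.ρ β) ≤ K * ∫ U, (F U - ((wilsonMeasure (d := 4) (L := 2 * S + 1) r.ρ β)[F|cylinderEvents (X := fun _ : Edge 4 (2 * S + 1) => G) {ℓ : Edge 4 (2 * S + 1) | (ℓ.1 0 - (t₀ - ((D - 1 : ℕ) : ZMod (2 * S + 1)))).val < w + 2 * (D - 1)}ᶜ])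 U) ^ 2 ∂(wilsonMeasure (d := 4) (L := 2 * S + 1) r.ρ β))
    (t₀ : ZMod (2 * S + 1)) (w : ℕ) {F : GaugeConfig 4 (2 * S + 1) G → ℝ} (hFm : Measurable F)
    {M : ℝ} (hFb : ∀ U, |F U| ≤ M)
    (hFd : DependsOn F {ℓ : Edge 4 (2 * S + 1) | (ℓ.1 0 - t₀).val < w}) :
    ∀ j : ℕ, 1 ≤ j → ∀ (a : ZMod (2 * S + 1)) (n : ℕ),
      a = t₀ - ((j * D - 1 : ℕ) : ZMod (2 * S + 1)) → n = w + 2 * (j * D - 1) →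
        w + 2 * (j * D) ≤ 2 * S →
          ∫ U, (((wilsonMeasure (d := 4) (L := 2 * S + 1) r.ρ β)[F|cylinderEvents
              (X := fun _ : Edge 4 (2 * S + 1) => G)
              {ℓ : Edge 4 (2 * S + 1) | (ℓ.1 0 - a).val < n}ᶜ]) U -
              ∫ V, F V ∂(wilsonMeasure (d := 4) (L := 2 * S + 1) r.ρ β)) ^ 2
              ∂(wilsonMeasure (d := 4) (L := 2 * S + 1) r.ρ β) ≤
            (1 - 1 / K) ^ j * ∫ U, (F U - ∫ V, F V ∂(wilsonMeasure (d := 4) (L := 2 * S + 1) r.ρ β)) ^ 2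
              ∂(wilsonMeasure (d := 4) (L := 2 * S + 1) r.ρ β) := by
  set μ : Measure (GaugeConfig 4 (2 * S + 1) G) := wilsonMeasure (d := 4) (L := 2 * S + 1) r.ρ β
    with hμ
  haveI : IsProbabilityMeasure μ :=
    isProbabilityMeasure_wilsonMeasure (d := 4) (L := 2 * S + 1) r.ρ r.continuous β
  have hK0 : 0 < K := one_pos.trans_le hK
  have hq0 : 0 ≤ 1 - 1 / K := by
    have : 1 / K ≤ 1 := by rw [div_le_one hK0]; exact hK
    linarith
  -- ONE STEP (the case `j = 1`, for an arbitrary slab): slab inequality + law of total variance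
  have one_step : ∀ (c : ZMod (2 * S + 1)) (v : ℕ), v + 2 * D ≤ 2 * S →
      ∀ H : GaugeConfig 4 (2 * S + 1) G → ℝ, Measurable H → ∀ C : ℝ, (∀ U, |H U| ≤ C) →
        DependsOn H {ℓ : Edge 4 (2 * S + 1) | (ℓ.1 0 - c).val < v} →
          ∫ U, ((μ[H|cylinderEvents (X := fun _ : Edge 4 (2 * S + 1) => G)
              {ℓ : Edge 4 (2 * S + 1) |
                (ℓ.1 0 - (c - ((D - 1 : ℕ) : ZMod (2 * S + 1)))).val < v + 2 * (D - 1)}ᶜ]) U -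
              ∫ V, H V ∂μ) ^ 2 ∂μ ≤
            (1 - 1 / K) * ∫ U, (H U - ∫ V, H V ∂μ) ^ 2 ∂μ := by
    intro c v hv H hHm C hHb hHd
    have hV := hslab c v hv H hHm ⟨C, hHb⟩ hHd
    exact le_mul_of_total_variance hK hV (integral_sq_sub_condExp_add cylinderEvents_le_pi
      hHm.aestronglyMeasurable (ae_of_all μ hHb))
  intro j hj
  induction j, hj using Nat.le_induction with
  | base =>
    intro a n ha hn hw
    rw [one_mul] at ha hn hw
    subst ha hn
    rw [pow_one]
    exact one_step t₀ w hw F hFm M hFb hFd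
  | succ j hj ih =>
    intro a n ha hn hw
    -- numerics of the margins
    have hsuccD : (j + 1) * D = j * D + D := add_one_mul j D
    have hjD' : D ≤ j * D := Nat.le_mul_of_pos_left D hj
    have hjD : 1 ≤ j * D := hD.trans hjD'
    have hjD1 : 1 ≤ (j + 1) * D := by omega
    -- the level-`j` interior parameters
    obtain ⟨a₁, ha₁⟩ : ∃ a₁ : ZMod (2 * S + 1), a₁ = t₀ - ((j * D - 1 : ℕ) : ZMod (2 * S + 1)) :=
      ⟨_, rfl⟩
    obtain ⟨n₁, hn₁⟩ : ∃ n₁ : ℕ, n₁ = w + 2 * (j * D - 1) := ⟨_, rfl⟩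
    have hw₁ : w + 2 * (j * D) ≤ 2 * S := by omega
    have hIH := ih a₁ n₁ ha₁ hn₁ hw₁
    have e1 : t₀ - ((j * D : ℕ) : ZMod (2 * S + 1)) = a₁ - 1 := by
      rw [ha₁, Nat.cast_sub hjD]; push_cast; ring
    have e2 : w + 2 * (j * D) = n₁ + 2 := by omega
    have e3 : a₁ - 1 - ((D - 1 : ℕ) : ZMod (2 * S + 1)) = a := by
      rw [ha, ha₁, Nat.cast_sub hjD, Nat.cast_sub hD, Nat.cast_sub hjD1]; push_cast; ring
    have e4 : n₁ + 2 + 2 * (D - 1) = n := by omega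
    have e5 : a₁ - (D : ZMod (2 * S + 1)) = a := by
      rw [ha, ha₁, Nat.cast_sub hjD, Nat.cast_sub hjD1]; push_cast; ring
    have e6 : n₁ + 2 * D = n := by omega
    -- the Markov version `Gj` of `μ[F | ext_{jD}]`, reading only the slab `(a₁ - 1, n₁ + 2)`
    have hn₁lt : n₁ + 2 < 2 * S + 1 := by omega
    have hFd₁ : DependsOn F {ℓ : Edge 4 (2 * S + 1) | (ℓ.1 0 - (a₁ - 1)).val < n₁ + 2} := by
      rw [← e1, ← e2]
      exact hFd.mono (slab_subset_enlarge t₀ w (j * D))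
    obtain ⟨Gj, hGm, hGb, hGd, hGae⟩ :=
      exists_slab_condExp_version r β S a₁ n₁ hn₁lt hFm hFb hFd₁
    have hGae' : Gj =ᵐ[μ] μ[F|cylinderEvents (X := fun _ : Edge 4 (2 * S + 1) => G)
        {ℓ : Edge 4 (2 * S + 1) | (ℓ.1 0 - a₁).val < n₁}ᶜ] := hGae
    -- one step applied to `Gj` on the slab `(a₁ - 1, n₁ + 2)`
    have hv : n₁ + 2 + 2 * D ≤ 2 * S := by omega
    have hstep := one_step (a₁ - 1) (n₁ + 2) hv Gj hGm M hGb hGd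
    rw [e3, e4] at hstep
    -- `∫ Gj = ∫ F`
    have hGint : ∫ V, Gj V ∂μ = ∫ V, F V ∂μ :=
      (integral_congr_ae hGae').trans (integral_condExp cylinderEvents_le_pi)
    rw [hGint] at hstep
    -- tower property along the nested exteriors
    have htower : μ[Gj|cylinderEvents (X := fun _ : Edge 4 (2 * S + 1) => G)
        {ℓ : Edge 4 (2 * S + 1) | (ℓ.1 0 - a).val < n}ᶜ] =ᵐ[μ]
        μ[F|cylinderEvents (X := fun _ : Edge 4 (2 * S + 1) => G)
          {ℓ : Edge 4 (2 * S + 1) | (ℓ.1 0 - a).val < n}ᶜ] := by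
      refine (condExp_congr_ae hGae').trans
        (condExp_condExp_of_le (cylinderEvents_mono ?_) cylinderEvents_le_pi)
      refine Set.compl_subset_compl.2 ?_
      rw [← e5, ← e6]
      exact slab_subset_enlarge a₁ n₁ D
    have hL : (fun U => (μ[Gj|cylinderEvents (X := fun _ : Edge 4 (2 * S + 1) => G)
        {ℓ : Edge 4 (2 * S + 1) | (ℓ.1 0 - a).val < n}ᶜ]) U - ∫ V, F V ∂μ) =ᵐ[μ]
        fun U => (μ[F|cylinderEvents (X := fun _ : Edge 4 (2 * S + 1) => G)
          {ℓ : Edge 4 (2 * S + 1) | (ℓ.1 0 - a).val < n}ᶜ]) U - ∫ V, F V ∂μ :=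
      htower.sub EventuallyEq.rfl
    have hR : (fun U => Gj U - ∫ V, F V ∂μ) =ᵐ[μ]
        fun U => (μ[F|cylinderEvents (X := fun _ : Edge 4 (2 * S + 1) => G)
          {ℓ : Edge 4 (2 * S + 1) | (ℓ.1 0 - a₁).val < n₁}ᶜ]) U - ∫ V, F V ∂μ :=
      hGae'.sub EventuallyEq.rfl
    rw [integral_sq_congr_ae hL, integral_sq_congr_ae hR] at hstep
    calc _ ≤ _ := hstep
      _ ≤ (1 - 1 / K) * ((1 - 1 / K) ^ j * ∫ U, (F U - ∫ V, F V ∂μ) ^ 2 ∂μ) :=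
          mul_le_mul_of_nonneg_left hIH hq0
      _ = (1 - 1 / K) ^ (j + 1) * ∫ U, (F U - ∫ V, F V ∂μ) ^ 2 ∂μ := by ring

end Wilson

/-- **Stub S2 (`SlabToDecay`, registered explicit form, the torus Wilson state abstracted as `μ`
with `μ = wilsonMeasure r.ρ β`): the slab inequality at margin `D` with constant `K` implies the
geometric decay `(1 - 1/K)^j` of `∫ (μ[F | exterior at margin jD] - ∫ F)²` for bounded slab
observables `F`.** Case `j = 0`: contraction; `j ≥ 1`: `decay_of_slabInequality`. -/
theorem stub_slabToDecay : ∀ (G : Type) [Group G] [TopologicalSpace G] [IsTopologicalGroup G] [CompactSpace G] [MeasurableSpace G] [BorelSpace G] (r : LatticeRep G) (β : ℝ) (S D : ℕ) (K : ℝ) (μ : Measure (GaugeConfig 4 (2 * S + 1) G)), μ = (wilsonMeasure r.ρ β : Measure (GaugeConfig 4 (2 * S + 1) G)) → 1 ≤ D → 1 ≤ K → (∀ (t₀ : ZMod (2 * S + 1)) (w : ℕ), w + 2 * D ≤ 2 * S → ∀ F : GaugeConfig 4 (2 * S + 1) G → ℝ, Measurable F → (∃ M : ℝ, ∀ U, |F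 U| ≤ M) → DependsOn F {ℓ : Edge 4 (2 * S + 1) | (ℓ.1 0 - t₀).val < w} → ∫ U, (F U - ∫ V, F V ∂μ) ^ 2 ∂μ ≤ K * ∫ U, (F U - (μ[F|cylinderEvents {ℓ : Edge 4 (2 * S + 1) | (ℓ.1 0 - (t₀ - ((D - 1 : ℕ) : ZMod (2 * S + 1)))).val < w + 2 * (D - 1)}ᶜ]) U) ^ 2 ∂μ) → ∀ (t₀ : ZMod (2 * S + 1)) (w j : ℕ), w + 2 * (j * D) ≤ 2 * S → ∀ F : GaugeConfig 4 (2 * S + 1) G → ℝ, Measurable F → (∃ M : ℝ, ∀ U, |F U| ≤ M) → DependsOn F {ℓ : Edge 4 (2 * S + 1) | (ℓ.1 0 - t₀).val < w} → ∫ U, ((μ[F|cylinderEvents {ℓ : Edge 4 (2 * S + 1) | (ℓ.1 0 - (t₀ - ((j * D - 1 : ℕ) : ZMod (2 * S + 1)))).val < w + 2 * (j * D - 1)}ᶜ]) U - ∫ V, F V ∂μ) ^ 2 ∂μ ≤ (1 - 1 / K) ^ j * ∫ U, (F U - ∫ V, F V ∂μ) ^ 2 ∂μ := by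
  intro G _ _ _ _ _ _ r β S D K μ hμ hD hK hslab t₀ w j hw F hFm hFb hFd
  subst hμ
  obtain ⟨M, hM⟩ := hFb
  rcases Nat.eq_zero_or_pos j with rfl | hj
  · haveI : IsProbabilityMeasure
        (wilsonMeasure (d := 4) (L := 2 * S + 1) r.ρ β : Measure (GaugeConfig 4 (2 * S + 1) G)) :=
      isProbabilityMeasure_wilsonMeasure (d := 4) (L := 2 * S + 1) r.ρ r.continuous β
    rw [pow_zero, one_mul]
    exact integral_condExp_sub_const_sq_le cylinderEvents_le_pi hFm.aestronglyMeasurable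
      (ae_of_all _ hM) _
  · exact decay_of_slabInequality r β S D K hD hK hslab t₀ w hFm hM hFd j hj _ _ rfl rfl hw

end Summit.QuantumFields.YangMills.Theorems.LatticeGapInUVUnits.FemtoSlabNondegeneracy

end
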